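import Literature.AlgebraicGeometry.Resolution.ValuedFunctionFieldsLemmas
import Mathlib.FieldTheory.SeparableClosure
import Mathlib.FieldTheory.IsAlgClosed.Basic
import Mathlib.FieldTheory.Perfect
import HarnessLib

/-!
# The separable closure of a valued field: divisible value group, algebraically closed residue field (Knaf–Kuhlmann 2009, Lemma 2.1)

Topic: `Literature/AlgebraicGeometry/Resolution`. A PROVED leaf in the decomposition of the
named fact `KnafKuhlmann2009_Thm11` (Knaf–Kuhlmann 2009, Thm. 1.1;
`FiniteExtensionUniformization.lean`): the case `n = 1` of its proof (§4.1, p. 20: "Since by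
assumption `vE/vK` is torsion and `EP|KP` is algebraic Lemma 2.1 implies that the extension
`(E^{sep}|K^{sep}, 𝓟)` and hence also its subextension `(E.K^{sep}|K^{sep}, 𝓟)` are
immediate") uses Lemma 2.1 ("Let `K` be an arbitrary field and `P` a non-trivial place on
`K^{sep}`. Then `v(K^{sep})` is the divisible hull `vK ⊗_ℤ ℚ` of `vK`, and `K^{sep}P` is the
algebraic closure of `KP`", for a proof of which the paper refers to [K4], Lemma 2.16). This
file proves what is used of it, for the relative separable closure `K^sep` of a subfield `K`
of an algebraically closed valued field `(Ω, V)` (Mathlib's `separableClosure K Ω`).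

* `mem_separableClosure_of_derivative_ne_zero`, `mem_separableClosure_of_separable` — PROVED:
  simple roots of polynomials over `K^sep` lie in `K^sep`.
* `exists_artinSchreier_root`, `exists_mem_separableClosure_valuation_pow_eq` — PROVED,
  **Lemma 2.1, value group**: `v(K^sep)` is divisible (`n`-th roots for `n` prime to the
  characteristic; Artin–Schreier roots of `X^p - X - c`, `v(c) > 1`, for the `p`-part).
* `exists_residue_pow_expChar_eq`, `perfectField_resField_separableClosure`,
  `exists_residue_eq_of_simple_root`, `exists_residue_eq_of_isAlgebraic` — PROVED,
  **Lemma 2.1, residue field** (for `v` non-trivial on `K`, which the statement needs):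
  `K^sep P` is perfect (roots of `X^p - πX - a`) and relatively separably closed (lifting
  simple roots of reductions of monic polynomials over `O_{K^sep}` through the algebraically
  closed `Ω`), hence every residue algebraic over `KP` is a residue of `O_{K^sep}`.
* `exists_pow_valuation_eq_of_eval_eq_zero`, `isAlgebraic_residue_of_eval_eq_zero` —
  PROVED (folklore): values of algebraic elements are torsion over the base value group (in
  an algebraic relation the maximal value is attained twice); residues of algebraic elements
  are algebraic over the residue field of the base.
* `exists_mem_separableClosure_valuation_eq`, `exists_mem_separableClosure_valuation_sub_lt`
  — PROVED, the use in §4.1: if `vE/vK` is torsion and `EP|KP` is algebraic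
  (`IsValueTorsionOver`, `IsResiduallyAlgebraicOver`), then `(E.K^sep | K^sep)` is immediate:
  every value of `E.K^sep` is a value of `K^sep` and every element of `O_{E.K^sep}` is
  congruent to an element of `O_{K^sep}`.

## Source

* H. Knaf, F.-V. Kuhlmann, *Every place admits local uniformization in a finite extension of
  the function field*, Adv. Math. 221 (2009) 428–453 = arXiv:math/0702856v1: Lemma 2.1
  (p. 7) and §4.1, proof of Thm. 1.1, case `n = 1` (p. 20). Pages refer to the arXiv PDF.

## Rendering notes

Ambient form as in `ValuedFunctionFields.lean`; `K^sep ↦ (separableClosure K Ω).toSubfield`;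
"`P` non-trivial" ↦ an element `π ∈ K` with `π ≠ 0`, `v(π) < 1` (only the residue-field half
needs it); values multiplicative (`V.valuation`).
-/

noncomputable section

namespace Literature.AlgebraicGeometry.Resolution

universe u

open Polynomial IsLocalRing

variable {Ω : Type u} [Field Ω] (V : ValuationSubring Ω) (K : Subfield Ω)

/-! ## The relative separable closure `K^sep ⊆ Ω` as a subfield -/

/-- Membership in the subfield underlying `separableClosure K Ω`. [folklore] -/
theorem mem_toSubfield_separableClosure_iff {x : Ω} :
    x ∈ (separableClosure K Ω).toSubfield ↔ IsSeparable K x :=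
  mem_separableClosure_iff

/-- `K ⊆ K^sep`. [folklore] -/
theorem le_toSubfield_separableClosure : K ≤ (separableClosure K Ω).toSubfield := fun x hx => by
  rw [mem_toSubfield_separableClosure_iff]
  exact isSeparable_algebraMap (⟨x, hx⟩ : K)

/-- **Simple roots of polynomials over `K^sep` lie in `K^sep`**: if `P` has coefficients in
`K^sep`, `P(x) = 0` and `P'(x) ≠ 0`, then `x` is separable over `K^sep` (its minimal
polynomial is irreducible with a simple root, hence separable), so `x ∈ K^sep`
(`separableClosure.separableClosure_eq_bot`). [folklore] -/
theorem mem_separableClosure_of_derivative_ne_zero {P : Polynomial Ω}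
    (hP : ∀ k, P.coeff k ∈ (separableClosure K Ω).toSubfield) {x : Ω} (hx : P.eval x = 0)
    (hx' : (derivative P).eval x ≠ 0) : x ∈ (separableClosure K Ω).toSubfield := by
  set L : IntermediateField K Ω := separableClosure K Ω with hL
  -- lift `P` to `L[X]`
  have hl : P ∈ Polynomial.lifts (algebraMap L Ω) :=
    (Polynomial.lifts_iff_coeff_lifts P).mpr fun k => ⟨⟨P.coeff k, hP k⟩, rfl⟩
  obtain ⟨PL, hPL⟩ := (Polynomial.mem_lifts P).mp hl
  have hPL0 : PL ≠ 0 := by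
    rintro rfl
    rw [Polynomial.map_zero] at hPL
    rw [← hPL, derivative_zero, eval_zero] at hx'
    exact hx' rfl
  have haeval : aeval x PL = 0 := by rw [aeval_def, ← eval_map, hPL, hx]
  have hint : IsIntegral L x := ⟨PL * C PL.leadingCoeff⁻¹, by
    rw [Monic, leadingCoeff_mul, leadingCoeff_C, mul_inv_cancel₀ (leadingCoeff_ne_zero.mpr hPL0)],
    by rw [← aeval_def, map_mul, haeval, zero_mul]⟩
  -- the minimal polynomial has `x` as a simple root
  have hsep : IsSeparable L x := by
    change (minpoly L x).Separable
    rw [Polynomial.separable_iff_derivative_ne_zero (minpoly.irreducible hint)]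
    intro hd
    obtain ⟨Q, hQ⟩ := minpoly.dvd L x haeval
    apply hx'
    have h1 : derivative P = ((derivative (minpoly L x)) * Q + minpoly L x * derivative Q).map
        (algebraMap L Ω) := by
      rw [← hPL, Polynomial.derivative_map, hQ, derivative_mul]
    rw [h1, hd, zero_mul, zero_add, eval_map, ← aeval_def, map_mul, minpoly.aeval, zero_mul]
  have hxbot : x ∈ separableClosure L Ω := mem_separableClosure_iff.mpr hsep
  rw [separableClosure.separableClosure_eq_bot] at hxbot
  obtain ⟨y, rfl⟩ := IntermediateField.mem_bot.mp hxbot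
  exact y.2

/-- Roots of separable polynomials over `K^sep` lie in `K^sep`. [folklore] -/
theorem mem_separableClosure_of_separable {P : Polynomial Ω}
    (hP : ∀ k, P.coeff k ∈ (separableClosure K Ω).toSubfield) (hsep : P.Separable) {x : Ω}
    (hx : P.eval x = 0) : x ∈ (separableClosure K Ω).toSubfield :=
  mem_separableClosure_of_derivative_ne_zero K hP hx
    (by have := hsep.aeval_derivative_ne_zero (x := x) (by rw [← coe_aeval_eq_eval] at hx; exact hx)
        rwa [coe_aeval_eq_eval] at this)

/-! ## The value group of `K^sep` is divisible (Knaf–Kuhlmann 2009, Lemma 2.1, first half) -/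

/-- Coefficients of `X^n - c`, of `X^q - X - c` and of `X^q - d X - c`. [folklore] -/
theorem coeff_X_pow_sub_C_mul_X_sub_C_mem {S : Subfield Ω} {n : ℕ} {c d : Ω} (hc : c ∈ S)
    (hd : d ∈ S) (k : ℕ) : (X ^ n - C d * X - C c : Polynomial Ω).coeff k ∈ S := by
  rw [coeff_sub, coeff_sub, coeff_X_pow, coeff_C_mul, coeff_X, coeff_C]
  refine sub_mem (sub_mem ?_ (mul_mem hd ?_)) ?_ <;> split_ifs <;>
    first | exact S.one_mem | exact S.zero_mem | exact hc

section Divisible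

variable [IsAlgClosed Ω]

/-- **Artin–Schreier roots**: in characteristic `q > 0`, for `v(c) > 1` (i.e. `|c| > 1`) a
root `ϑ` of `X^q - X - c` has `v(ϑ)^q = v(c)`, and `ϑ ∈ K^sep` if `c ∈ K^sep`. [folklore] -/
theorem exists_artinSchreier_root {q : ℕ} [hq : Fact q.Prime] [CharP Ω q] {c : Ω}
    (hcK : c ∈ (separableClosure K Ω).toSubfield) (hvc : 1 < V.valuation c) :
    ∃ ϑ ∈ (separableClosure K Ω).toSubfield, ϑ ≠ 0 ∧ V.valuation ϑ ^ q = V.valuation c := by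
  set P : Polynomial Ω := X ^ q - C 1 * X - C c with hPdef
  have hq1 : 1 < q := hq.out.one_lt
  have hdeg : P.degree = q := by
    rw [hPdef, map_one, one_mul, sub_sub, degree_sub_eq_left_of_degree_lt] <;>
      rw [degree_X_pow]
    refine (degree_add_le _ _).trans_lt ?_
    rw [degree_X]
    refine max_lt (by exact_mod_cast hq1) ((degree_C_le).trans_lt (by exact_mod_cast hq.out.pos))
  have hdeg0 : P.degree ≠ 0 := by rw [hdeg]; exact_mod_cast hq.out.ne_zero
  obtain ⟨ϑ, hϑ⟩ := IsAlgClosed.exists_root P hdeg0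
  have hroot : P.eval ϑ = 0 := hϑ
  have hsepP : P.Separable := by
    rw [Polynomial.separable_def']
    refine ⟨0, -1, ?_⟩
    have hder : derivative P = -1 := by
      rw [hPdef, map_one, one_mul, derivative_sub, derivative_sub, derivative_X_pow, derivative_X,
        derivative_C, sub_zero, CharP.cast_eq_zero Ω q, C_0, zero_mul, zero_sub]
    rw [hder]; ring
  have hϑK : ϑ ∈ (separableClosure K Ω).toSubfield :=
    mem_separableClosure_of_separable K
      (coeff_X_pow_sub_C_mul_X_sub_C_mem hcK (Subfield.one_mem _)) hsepP hroot
  -- `ϑ^q - ϑ = c` forces `v(ϑ) > 1` and `v(ϑ)^q = v(c)`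
  have heq : ϑ ^ q - ϑ = c := by
    have : P.eval ϑ = ϑ ^ q - ϑ - c := by simp [hPdef]
    rw [this] at hroot
    exact (sub_eq_zero.mp hroot)
  have hvϑ : 1 < V.valuation ϑ := by
    by_contra hle
    rw [not_lt] at hle
    have : V.valuation (ϑ ^ q - ϑ) ≤ 1 := by
      refine (Valuation.map_sub _ _ _).trans (max_le ?_ hle)
      rw [map_pow]; exact pow_le_one' hle _
    rw [heq] at this
    exact absurd hvc (not_lt.mpr this)
  have hϑ0 : ϑ ≠ 0 := fun h0 => by rw [h0, map_zero] at hvϑ; exact not_lt_zero hvϑ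
  have hlt : V.valuation ϑ < V.valuation (ϑ ^ q) := by
    rw [map_pow]
    calc V.valuation ϑ = V.valuation ϑ ^ 1 := (pow_one _).symm
      _ < V.valuation ϑ ^ q := pow_lt_pow_right₀ hvϑ hq1
  refine ⟨ϑ, hϑK, hϑ0, ?_⟩
  rw [← heq, Valuation.map_sub_eq_of_lt_left _ hlt, map_pow]

/-- **`v(K^sep)` is divisible** (Knaf–Kuhlmann 2009, Lemma 2.1: "`v(K^sep)` is the divisible
hull `vK ⊗_ℤ ℚ` of `vK`"): for `c ∈ K^sep`, `c ≠ 0`, and `n ≠ 0` there is `b ∈ K^sep` with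
`v(b)^n = v(c)` (roots of `X^n - c` for `n` prime to the characteristic, Artin–Schreier roots
for the `p`-part). PROVED. [cite: KnafKuhlmann2009, Lemma 2.1] -/
theorem exists_mem_separableClosure_valuation_pow_eq {c : Ω}
    (hcK : c ∈ (separableClosure K Ω).toSubfield) (hc0 : c ≠ 0) {n : ℕ} (hn : n ≠ 0) :
    ∃ b ∈ (separableClosure K Ω).toSubfield, b ≠ 0 ∧ V.valuation b ^ n = V.valuation c := by
  induction n using Nat.strong_induction_on generalizing c with
  | _ n ih =>
  -- the case `(n : Ω) ≠ 0`: roots of `X^n - c`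
  by_cases hnΩ : (n : Ω) ≠ 0
  · set P : Polynomial Ω := X ^ n - C 0 * X - C c with hPdef
    have hP : P = X ^ n - C c := by rw [hPdef, map_zero, zero_mul, sub_zero]
    have hsepP : P.Separable := by rw [hP]; exact separable_X_pow_sub_C c hnΩ hc0
    have hdeg0 : P.degree ≠ 0 := by
      rw [hP, degree_X_pow_sub_C (Nat.pos_of_ne_zero hn)]
      exact_mod_cast hn
    obtain ⟨b, hb⟩ := IsAlgClosed.exists_root P hdeg0
    have hroot : P.eval b = 0 := hb
    have hbK : b ∈ (separableClosure K Ω).toSubfield :=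
      mem_separableClosure_of_separable K
        (coeff_X_pow_sub_C_mul_X_sub_C_mem hcK (Subfield.zero_mem _)) hsepP hroot
    have hbn : b ^ n = c := by
      rw [hP, eval_sub, eval_pow, eval_X, eval_C, sub_eq_zero] at hroot
      exact hroot
    refine ⟨b, hbK, fun h0 => hc0 ?_, by rw [← map_pow, hbn]⟩
    rw [← hbn, h0, zero_pow hn]
  -- the case `char Ω = q ∣ n`: an Artin–Schreier step, then induction
  rw [not_not] at hnΩ
  obtain ⟨q, hqchar⟩ := CharP.exists Ω
  have hqn : q ∣ n := (CharP.cast_eq_zero_iff Ω q n).mp hnΩ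
  rcases CharP.char_is_prime_or_zero Ω q with hq | hq
  swap
  · exfalso
    rw [hq, zero_dvd_iff] at hqn
    exact hn hqn
  haveI : Fact q.Prime := ⟨hq⟩
  obtain ⟨n', rfl⟩ := hqn
  have hn' : n' ≠ 0 := fun h => hn (by rw [h, mul_zero])
  have hn'lt : n' < q * n' := lt_mul_left (Nat.pos_of_ne_zero hn') hq.one_lt
  -- the Artin–Schreier step: `b₁ ∈ K^sep` with `v(b₁)^q = v(c)`
  obtain ⟨b₁, hb₁K, hb₁0, hb₁⟩ : ∃ b₁ ∈ (separableClosure K Ω).toSubfield, b₁ ≠ 0 ∧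
      V.valuation b₁ ^ q = V.valuation c := by
    rcases lt_trichotomy 1 (V.valuation c) with hvc | hvc | hvc
    · obtain ⟨ϑ, hϑK, hϑ0, hϑ⟩ := exists_artinSchreier_root V K hcK hvc
      exact ⟨ϑ, hϑK, hϑ0, hϑ⟩
    · exact ⟨1, Subfield.one_mem _, one_ne_zero, by rw [map_one, one_pow, hvc]⟩
    · have hci : 1 < V.valuation c⁻¹ := by
        rw [map_inv₀]; exact one_lt_inv_iff₀.mpr ⟨zero_lt_iff.mpr ((_root_.map_ne_zero _).mpr hc0), hvc⟩
      obtain ⟨ϑ, hϑK, hϑ0, hϑ⟩ := exists_artinSchreier_root V K (inv_mem hcK) hci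
      refine ⟨ϑ⁻¹, inv_mem hϑK, inv_ne_zero hϑ0, ?_⟩
      rw [map_inv₀, inv_pow, hϑ, map_inv₀, inv_inv]
  obtain ⟨b, hbK, hb0, hb⟩ := ih n' hn'lt hb₁K hb₁0 hn'
  refine ⟨b, hbK, hb0, ?_⟩
  rw [mul_comm, pow_mul, hb, hb₁]

end Divisible

/-! ## Residues -/

/-- Two elements of `V` have the same residue iff their difference has value `< 1`.
[folklore] -/
theorem residue_eq_residue_iff (a b : V) :
    residue V a = residue V b ↔ V.valuation ((a : Ω) - b) < 1 := by
  rw [← sub_eq_zero, ← map_sub, residue_eq_zero_iff, ValuationSubring.valuation_lt_one_iff]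
  rfl

/-- Reduction of polynomials over `V`: evaluation commutes with the residue map. [folklore] -/
theorem residue_eval (g : Polynomial V) (β : V) :
    residue V (g.eval β) = (g.map (residue V)).eval (residue V β) := by
  rw [eval_map, eval₂_at_apply]

/-- Evaluation in `Ω` of a polynomial over `V`. [folklore] -/
theorem algebraMap_eval (g : Polynomial V) (β : V) :
    ((g.eval β : V) : Ω) = (g.map (algebraMap V Ω)).eval (β : Ω) := by
  rw [eval_map]
  change _ = eval₂ (algebraMap V Ω) (algebraMap V Ω β) g
  rw [eval₂_at_apply]
  rfl

/-! ## The residue field of `K^sep` is algebraically closed in the residue field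
(Knaf–Kuhlmann 2009, Lemma 2.1, second half) -/

section Residues

variable [IsAlgClosed Ω]

/-- **`p`-th roots of residues**: if `v` is non-trivial on `K` (`π ∈ K`, `0 < v(π) < 1`), every
residue of an element of `O_{K^sep}` has a `p`-th root among such residues, `p` the residue
characteristic exponent (roots of `X^p - a` in characteristic `0`, of `X^p - π X - a` in
characteristic `p`: separable polynomials, with roots in `V`). [folklore] -/
theorem exists_residue_pow_expChar_eq {π : Ω} (hπK : π ∈ K) (hπ0 : π ≠ 0)
    (hvπ : V.valuation π < 1) (p : ℕ) [ExpChar (ResidueField V) p] (a : V)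
    (haK : (a : Ω) ∈ (separableClosure K Ω).toSubfield) :
    ∃ b : V, (b : Ω) ∈ (separableClosure K Ω).toSubfield ∧ residue V b ^ p = residue V a := by
  set Ks := (separableClosure K Ω).toSubfield with hKs
  have hπKs : π ∈ Ks := le_toSubfield_separableClosure K hπK
  -- the characteristic exponent `p` of the residue field: `p = 1` or `p` prime with `p = 0` there
  rcases ‹ExpChar (ResidueField V) p› with _ | ⟨hp⟩
  · exact ⟨a, haK, by rw [pow_one]⟩
  haveI : Fact p.Prime := ⟨hp⟩
  by_cases ha0 : (a : Ω) = 0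
  · refine ⟨0, by simp [Ks.zero_mem], ?_⟩
    have : a = 0 := Subtype.ext ha0
    rw [this, map_zero, zero_pow hp.ne_zero]
  -- the lifting polynomial: `X^p - a` if `p ≠ 0` in `Ω`, `X^p - π X - a` if `p = 0` in `Ω`
  obtain ⟨d, hdK, hdV, hvd, hsep⟩ : ∃ d ∈ Ks, d ∈ V ∧ V.valuation d < 1 ∧
      (X ^ p - C d * X - C (a : Ω) : Polynomial Ω).Separable := by
    by_cases hpΩ : (p : Ω) = 0
    · haveI : CharP Ω p := by
        haveI := (CharP.charP_iff_prime_eq_zero hp).mpr hpΩ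
        exact this
      refine ⟨π, hπKs, (V.valuation_le_one_iff π).mp hvπ.le, hvπ, ?_⟩
      have hder : derivative (X ^ p - C π * X - C (a : Ω) : Polynomial Ω) = -C π := by
        rw [derivative_sub, derivative_sub, derivative_X_pow, derivative_C, sub_zero,
          CharP.cast_eq_zero Ω p, C_0, zero_mul, zero_sub, derivative_C_mul_X]
      rw [Polynomial.separable_def']
      refine ⟨0, -C π⁻¹, ?_⟩
      rw [hder, zero_mul, zero_add, neg_mul_neg, ← C_mul, inv_mul_cancel₀ hπ0, C_1]
    · refine ⟨0, Ks.zero_mem, V.zero_mem, by rw [map_zero]; exact zero_lt_one, ?_⟩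
      rw [map_zero, zero_mul, sub_zero]
      exact separable_X_pow_sub_C (a : Ω) hpΩ ha0
  set P : Polynomial Ω := X ^ p - C d * X - C (a : Ω) with hPdef
  have hdeg : P.degree = p := by
    rw [hPdef, sub_sub, degree_sub_eq_left_of_degree_lt] <;> rw [degree_X_pow]
    refine (degree_add_le _ _).trans_lt (max_lt ?_ ?_)
    · refine (degree_C_mul_X_le d).trans_lt ?_
      exact_mod_cast hp.one_lt
    · exact (degree_C_le).trans_lt (by exact_mod_cast hp.pos)
  have hdeg0 : P.degree ≠ 0 := by rw [hdeg]; exact_mod_cast hp.ne_zero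
  obtain ⟨b, hb⟩ := IsAlgClosed.exists_root P hdeg0
  have hroot : P.eval b = 0 := hb
  have hbKs : b ∈ Ks := mem_separableClosure_of_separable K
    (coeff_X_pow_sub_C_mul_X_sub_C_mem haK hdK) hsep hroot
  have heq : b ^ p = d * b + a := by
    have : P.eval b = b ^ p - d * b - a := by simp [hPdef]
    rw [this] at hroot
    linear_combination hroot
  -- `b ∈ V`
  have hbV : b ∈ V := by
    by_contra hbV
    have hvb : 1 < V.valuation b := by
      rw [← not_le, V.valuation_le_one_iff]; exact hbV
    have hb0 : V.valuation b ≠ 0 := ne_of_gt (lt_trans zero_lt_one hvb)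
    have h1 : V.valuation (d * b + a) < V.valuation b ^ p := by
      refine (Valuation.map_add _ _ _).trans_lt (max_lt ?_ ?_)
      · rw [map_mul]
        calc V.valuation d * V.valuation b < 1 * V.valuation b := mul_lt_mul_of_pos_right hvd
              (zero_lt_iff.mpr hb0)
          _ = V.valuation b ^ 1 := by rw [one_mul, pow_one]
          _ ≤ V.valuation b ^ p := pow_le_pow_right₀ hvb.le hp.one_le
      · calc V.valuation (a : Ω) ≤ 1 := (V.valuation_le_one_iff _).mpr a.2
          _ < V.valuation b := hvb
          _ = V.valuation b ^ 1 := (pow_one _).symm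
          _ ≤ V.valuation b ^ p := pow_le_pow_right₀ hvb.le hp.one_le
    rw [← heq, map_pow] at h1
    exact lt_irrefl _ h1
  refine ⟨⟨b, hbV⟩, hbKs, ?_⟩
  -- residues: `b̄^p = d̄ b̄ + ā = ā`
  have hres0 : residue V ⟨d, hdV⟩ = 0 :=
    (residue_eq_zero_iff _).mpr ((ValuationSubring.valuation_lt_one_iff V _).mpr hvd)
  have : (⟨b, hbV⟩ : V) ^ p = ⟨d, hdV⟩ * ⟨b, hbV⟩ + a := Subtype.ext heq
  rw [← map_pow, this, map_add, map_mul, hres0, zero_mul, zero_add]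

/-- The residue field `K^sep P` of `K^sep` is perfect (for `v` non-trivial on `K`).
[folklore] -/
theorem perfectField_resField_separableClosure {π : Ω} (hπK : π ∈ K) (hπ0 : π ≠ 0)
    (hvπ : V.valuation π < 1) :
    PerfectField (resField V (separableClosure K Ω).toSubfield) := by
  set R := resField V (separableClosure K Ω).toSubfield with hR
  obtain ⟨p, hp⟩ := ExpChar.exists (ResidueField V)
  haveI := hp
  haveI : ExpChar R p := RingHom.expChar R.subtype Subtype.val_injective p
  haveI : PerfectRing R p := by
    refine PerfectRing.ofSurjective R p fun s => ?_
    obtain ⟨a, haK, has⟩ := (mem_resField_iff V _ s.1).mp s.2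
    obtain ⟨b, hbK, hb⟩ := exists_residue_pow_expChar_eq V K hπK hπ0 hvπ p a haK
    refine ⟨⟨residue V b, residue_mem_resField V b hbK⟩, Subtype.ext ?_⟩
    rw [frobenius_def]
    change residue V b ^ p = (s : ResidueField V)
    rw [hb, has]
  exact PerfectRing.toPerfectField R p

/-- **Lifting simple roots**: a residue `r` that is a simple root of the reduction of a monic
polynomial with coefficients in `O_{K^sep}` is the residue of an element of `O_{K^sep}` (over
the algebraically closed `Ω` the polynomial splits with roots in `V`; one of them reduces to
`r`, and it is a simple root, hence separable over `K^sep`). [folklore] -/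
theorem exists_residue_eq_of_simple_root (g : Polynomial V) (hg : g.Monic)
    (hgK : ∀ k, ((g.coeff k : V) : Ω) ∈ (separableClosure K Ω).toSubfield) (r : ResidueField V)
    (hr : (g.map (residue V)).eval r = 0) (hr' : (derivative (g.map (residue V))).eval r ≠ 0) :
    ∃ c : V, (c : Ω) ∈ (separableClosure K Ω).toSubfield ∧ residue V c = r := by
  classical
  set gΩ : Polynomial Ω := g.map (algebraMap V Ω) with hgΩ
  have hgΩmon : gΩ.Monic := hg.map _
  have hsplit := (IsAlgClosed.splits gΩ).eq_prod_roots_of_monic hgΩmon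
  -- all roots of `gΩ` lie in `V`
  have hrootsV : ∀ b ∈ gΩ.roots, b ∈ V := by
    intro b hb
    have hb' : gΩ.eval b = 0 := (mem_roots hgΩmon.ne_zero).mp hb
    refine mem_of_isIntegral_of_le (S := V.toSubring) le_rfl ⟨g, hg, ?_⟩
    rw [← eval_map]; exact hb'
  -- a lift `ρ` of `r`; `v(g(ρ)) < 1`, so some root `b` has `v(ρ - b) < 1`
  obtain ⟨ρ, hρ⟩ := residue_surjective (R := V) r
  have hvρ : V.valuation ((g.eval ρ : V) : Ω) < 1 := by
    rw [← ValuationSubring.valuation_lt_one_iff, ← residue_eq_zero_iff, residue_eval, hρ, hr]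
  have hprod : ((g.eval ρ : V) : Ω) = (gΩ.roots.map fun b => (ρ : Ω) - b).prod := by
    rw [algebraMap_eval, ← hgΩ]
    conv_lhs => rw [hsplit]
    rw [eval_multiset_prod, Multiset.map_map]
    refine congrArg _ (Multiset.map_congr rfl fun b _ => ?_)
    simp
  obtain ⟨b, hbroot, hvb⟩ : ∃ b ∈ gΩ.roots, V.valuation ((ρ : Ω) - b) < 1 := by
    by_contra hall
    push Not at hall
    have : V.valuation ((g.eval ρ : V) : Ω) = 1 := by
      rw [hprod, map_multiset_prod, Multiset.map_map]
      refine Multiset.prod_eq_one fun x hx => ?_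
      obtain ⟨b, hb, rfl⟩ := Multiset.mem_map.mp hx
      refine le_antisymm ?_ (hall b hb)
      exact (V.valuation_le_one_iff _).mpr (sub_mem ρ.2 (hrootsV b hb))
    rw [this] at hvρ
    exact lt_irrefl _ hvρ
  have hbV : b ∈ V := hrootsV b hbroot
  have hres : residue V ⟨b, hbV⟩ = r := by
    rw [← hρ, eq_comm, residue_eq_residue_iff]
    exact hvb
  -- `b` is a simple root of `gΩ`, hence in `K^sep`
  have hgb : gΩ.eval b = 0 := (mem_roots hgΩmon.ne_zero).mp hbroot
  have hgb' : (derivative gΩ).eval b ≠ 0 := by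
    intro h0
    apply hr'
    have h1 : (derivative g).eval ⟨b, hbV⟩ = 0 := by
      apply Subtype.val_injective
      rw [algebraMap_eval, ← Polynomial.derivative_map, ← hgΩ]
      exact h0
    rw [← hres, Polynomial.derivative_map, ← residue_eval, h1, map_zero]
  refine ⟨⟨b, hbV⟩, mem_separableClosure_of_derivative_ne_zero K (P := gΩ) (fun k => ?_) hgb hgb',
    hres⟩
  rw [hgΩ, coeff_map]
  exact hgK k

/-- **`K^sep P` is algebraically closed in the residue field** (Knaf–Kuhlmann 2009, Lemma 2.1:
"`K^sep P` is the algebraic closure of `KP`"), for `v` non-trivial on `K`: every residue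
algebraic over `KP` is the residue of an element of `O_{K^sep}`. PROVED (the residue field
of `K^sep` is perfect, so the residue is separable over it; lift its minimal polynomial and
apply `exists_residue_eq_of_simple_root`). [cite: KnafKuhlmann2009, Lemma 2.1] -/
theorem exists_residue_eq_of_isAlgebraic {π : Ω} (hπK : π ∈ K) (hπ0 : π ≠ 0)
    (hvπ : V.valuation π < 1) {r : ResidueField V} (hr : IsAlgebraic (resField V K) r) :
    ∃ c : V, (c : Ω) ∈ (separableClosure K Ω).toSubfield ∧ residue V c = r := by
  classical
  set Ks := (separableClosure K Ω).toSubfield with hKs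
  set R := resField V Ks with hR
  haveI : PerfectField R := perfectField_resField_separableClosure V K hπK hπ0 hvπ
  have hKR : resField V K ≤ R := resField_mono V (le_toSubfield_separableClosure K)
  have hrR : IsAlgebraic R r := isAlgebraic_of_subfield_le hKR hr
  have hsep : IsSeparable R r :=
    PerfectField.separable_of_irreducible (minpoly.irreducible hrR.isIntegral)
  -- lift the minimal polynomial to a monic polynomial over `V` with coefficients in `K^sep`
  set μ := minpoly R r with hμ
  have hμm : μ.Monic := minpoly.monic hrR.isIntegral
  have hlift : ∀ s : R, ∃ a : V, (a : Ω) ∈ Ks ∧ residue V a = s := fun s =>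
    (mem_resField_iff V Ks s.1).mp s.2
  choose lift hliftK hlift using hlift
  set d := μ.natDegree with hd
  set g : Polynomial V := X ^ d + ∑ i ∈ Finset.range d, C (lift (μ.coeff i)) * X ^ i with hgdef
  have hdeglt : (∑ i ∈ Finset.range d, C (lift (μ.coeff i)) * X ^ i).degree < (d : WithBot ℕ) := by
    refine (degree_sum_le _ _).trans_lt ?_
    refine (Finset.sup_lt_iff (WithBot.bot_lt_coe d)).mpr fun i hi => ?_
    refine (degree_C_mul_X_pow_le i _).trans_lt ?_
    exact WithBot.coe_lt_coe.mpr (Finset.mem_range.mp hi)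
  have hgm : g.Monic := by
    rw [hgdef]
    exact Monic.add_of_left (monic_X_pow d) (by rw [degree_X_pow]; exact hdeglt)
  have hgcoeff : ∀ k, g.coeff k = if k = d then 1 else if k < d then lift (μ.coeff k) else 0 := by
    intro k
    rw [hgdef, coeff_add, coeff_X_pow, finsetSum_coeff]
    simp only [coeff_C_mul_X_pow]
    rw [Finset.sum_ite_eq]
    simp only [Finset.mem_range]
    by_cases hk : k = d
    · simp [hk]
    · simp [hk]
  have hgK : ∀ k, ((g.coeff k : V) : Ω) ∈ Ks := by
    intro k
    rw [hgcoeff]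
    split_ifs
    · exact Ks.one_mem
    · exact hliftK _
    · exact Ks.zero_mem
  -- the reduction of `g` is `μ` (mapped into the residue field)
  have hred : g.map (residue V) = μ.map (algebraMap R (ResidueField V)) := by
    ext k
    rw [coeff_map, coeff_map, hgcoeff]
    split_ifs with h1 h2
    · rw [map_one, h1]
      change (1 : ResidueField V) = ((μ.coeff μ.natDegree : R) : ResidueField V)
      rw [← Polynomial.leadingCoeff, hμm.leadingCoeff]; rfl
    · rw [hlift]; rfl
    · have : μ.coeff k = 0 := coeff_eq_zero_of_natDegree_lt (by omega)
      rw [map_zero, this]; rfl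
  have hr0 : (g.map (residue V)).eval r = 0 := by
    rw [hred, eval_map, ← aeval_def, hμ, minpoly.aeval]
  have hr1 : (derivative (g.map (residue V))).eval r ≠ 0 := by
    rw [hred, Polynomial.derivative_map, eval_map, ← aeval_def]
    exact hsep.aeval_derivative_ne_zero (minpoly.aeval R r)
  exact exists_residue_eq_of_simple_root V K g hgm hgK r hr0 hr1

end Residues

/-! ## Values and residues of algebraic elements -/

/-- **In an algebraic relation the maximal value is attained twice**: if `P(w) = 0` for a
non-zero polynomial `P` with coefficients in the subfield `E` and `w ≠ 0`, then
`v(w)^n = v(e)` for some `n ≠ 0` and `e ∈ E^×` (the quotient of two coefficients). So the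
value group of an algebraic extension is torsion over that of the base. [folklore] -/
theorem exists_pow_valuation_eq_of_eval_eq_zero (E : Subfield Ω) {P : Polynomial Ω}
    (hP0 : P ≠ 0) (hPE : ∀ k, P.coeff k ∈ E) {w : Ω} (hw0 : w ≠ 0) (hPw : P.eval w = 0) :
    ∃ n : ℕ, n ≠ 0 ∧ ∃ e ∈ E, e ≠ 0 ∧ V.valuation w ^ n = V.valuation e := by
  classical
  set d := P.natDegree with hd
  set f : ℕ → Ω := fun i => P.coeff i * w ^ i with hf
  have hsum : ∑ i ∈ Finset.range (d + 1), f i = 0 := by rw [← hPw, eval_eq_sum_range]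
  set I := (Finset.range (d + 1)).filter (fun i => P.coeff i ≠ 0) with hI
  have hdI : d ∈ I := Finset.mem_filter.mpr
    ⟨Finset.self_mem_range_succ d, leadingCoeff_ne_zero.mpr hP0⟩
  obtain ⟨i₀, hi₀I, hmax⟩ := Finset.exists_max_image I (fun i => V.valuation (f i)) ⟨d, hdI⟩
  have hi₀ : i₀ ∈ Finset.range (d + 1) := (Finset.mem_filter.mp hi₀I).1
  have hc₀ : P.coeff i₀ ≠ 0 := (Finset.mem_filter.mp hi₀I).2
  have hf₀ : f i₀ ≠ 0 := mul_ne_zero hc₀ (pow_ne_zero _ hw0)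
  have hvf₀ : V.valuation (f i₀) ≠ 0 := (_root_.map_ne_zero _).mpr hf₀
  -- a second index with the same (maximal) value
  obtain ⟨i₁, hi₁I, hne, heq⟩ : ∃ i₁ ∈ I, i₁ ≠ i₀ ∧ V.valuation (f i₁) = V.valuation (f i₀) := by
    by_contra hno
    push Not at hno
    have hlt : ∀ i ∈ Finset.range (d + 1) \ {i₀}, V.valuation (f i) < V.valuation (f i₀) := by
      intro i hi
      rw [Finset.mem_sdiff, Finset.mem_singleton] at hi
      by_cases hci : P.coeff i = 0
      · rw [hf]; dsimp only; rw [hci, zero_mul, map_zero]; exact zero_lt_iff.mpr hvf₀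
      · have hiI : i ∈ I := Finset.mem_filter.mpr ⟨hi.1, hci⟩
        exact lt_of_le_of_ne (hmax i hiI) (hno i hiI hi.2)
    have := Valuation.map_sum_eq_of_lt V.valuation hi₀ hlt
    rw [hsum, map_zero] at this
    exact hvf₀ this.symm
  have hc₁ : P.coeff i₁ ≠ 0 := (Finset.mem_filter.mp hi₁I).2
  -- `v(P_{i₁}) v(w)^{i₁} = v(P_{i₀}) v(w)^{i₀}`
  rw [hf] at heq
  dsimp only at heq
  rw [map_mul, map_mul, map_pow, map_pow] at heq
  have hvw0 : V.valuation w ≠ 0 := (_root_.map_ne_zero _).mpr hw0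
  have hvc₀ : V.valuation (P.coeff i₀) ≠ 0 := (_root_.map_ne_zero _).mpr hc₀
  have hvc₁ : V.valuation (P.coeff i₁) ≠ 0 := (_root_.map_ne_zero _).mpr hc₁
  rcases Nat.lt_or_gt_of_ne hne with hlt | hlt
  · obtain ⟨n, hn⟩ : ∃ n, i₀ = i₁ + n := ⟨i₀ - i₁, by omega⟩
    refine ⟨n, by omega, P.coeff i₁ / P.coeff i₀, div_mem (hPE _) (hPE _), div_ne_zero hc₁ hc₀, ?_⟩
    rw [map_div₀, eq_div_iff hvc₀]
    have h2 : V.valuation w ^ i₀ = V.valuation w ^ i₁ * V.valuation w ^ n := by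
      rw [← pow_add, ← hn]
    rw [h2] at heq
    have h3 : V.valuation (P.coeff i₁) * V.valuation w ^ i₁ =
        V.valuation (P.coeff i₀) * V.valuation w ^ n * V.valuation w ^ i₁ := by
      rw [heq, mul_assoc, mul_comm (V.valuation w ^ n)]
    have h4 := mul_right_cancel₀ (pow_ne_zero i₁ hvw0) h3
    rw [h4, mul_comm]
  · obtain ⟨n, hn⟩ : ∃ n, i₁ = i₀ + n := ⟨i₁ - i₀, by omega⟩
    refine ⟨n, by omega, P.coeff i₀ / P.coeff i₁, div_mem (hPE _) (hPE _), div_ne_zero hc₀ hc₁, ?_⟩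
    rw [map_div₀, eq_div_iff hvc₁]
    have h2 : V.valuation w ^ i₁ = V.valuation w ^ i₀ * V.valuation w ^ n := by
      rw [← pow_add, ← hn]
    rw [h2] at heq
    have h3 : V.valuation (P.coeff i₁) * V.valuation w ^ n * V.valuation w ^ i₀ =
        V.valuation (P.coeff i₀) * V.valuation w ^ i₀ := by
      rw [← heq, mul_assoc, mul_comm (V.valuation w ^ n)]
    have h4 := mul_right_cancel₀ (pow_ne_zero i₀ hvw0) h3
    rw [mul_comm]; exact h4

/-- **Residues of algebraic elements are algebraic**: if `w ∈ V` is a root of a non-zero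
polynomial with coefficients in the subfield `E`, then its residue is algebraic over the
residue field of `E` (normalise the relation by a coefficient of maximal value and reduce).
[folklore] -/
theorem isAlgebraic_residue_of_eval_eq_zero (E : Subfield Ω) {P : Polynomial Ω} (hP0 : P ≠ 0)
    (hPE : ∀ k, P.coeff k ∈ E) {w : Ω} (hwV : w ∈ V) (hPw : P.eval w = 0) :
    IsAlgebraic (resField V E) (residue V ⟨w, hwV⟩) := by
  classical
  -- normalise
  have hsupp : P.support.Nonempty := by
    rw [Finset.nonempty_iff_ne_empty, Ne, Polynomial.support_eq_empty]; exact hP0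
  obtain ⟨i₀, hi₀, hmax⟩ :=
    Finset.exists_max_image P.support (fun i => V.valuation (P.coeff i)) hsupp
  set c := P.coeff i₀ with hc
  have hc0 : c ≠ 0 := mem_support_iff.mp hi₀
  have hvc : V.valuation c ≠ 0 := (_root_.map_ne_zero _).mpr hc0
  set Q : Polynomial Ω := C c⁻¹ * P with hQdef
  have hQcoeff : ∀ i, Q.coeff i = c⁻¹ * P.coeff i := fun i => by rw [hQdef, coeff_C_mul]
  have hQE : ∀ i, Q.coeff i ∈ E := fun i => by
    rw [hQcoeff]; exact E.mul_mem (E.inv_mem (hPE i₀)) (hPE i)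
  have hQV : ∀ i, Q.coeff i ∈ V := by
    intro i
    rw [← V.valuation_le_one_iff, hQcoeff, map_mul, map_inv₀]
    by_cases hi : i ∈ P.support
    · calc (V.valuation c)⁻¹ * V.valuation (P.coeff i) ≤ (V.valuation c)⁻¹ * V.valuation c := by
            gcongr; exact hmax i hi
        _ = 1 := inv_mul_cancel₀ hvc
    · rw [notMem_support_iff.mp hi, map_zero, mul_zero]; exact zero_le
  have hQi₀ : Q.coeff i₀ = 1 := by rw [hQcoeff, ← hc, inv_mul_cancel₀ hc0]
  have hQw : Q.eval w = 0 := by rw [hQdef, eval_mul, hPw, mul_zero]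
  -- lift to `V[X]` and reduce
  obtain ⟨QV, hQV'⟩ : ∃ QV : Polynomial V, QV.map (algebraMap V Ω) = Q :=
    (mem_lifts Q).mp ((lifts_iff_coeff_lifts Q).mpr fun k => ⟨⟨Q.coeff k, hQV k⟩, rfl⟩)
  have hQVcoeff : ∀ k, ((QV.coeff k : V) : Ω) = Q.coeff k := fun k => by
    rw [← hQV', coeff_map]; rfl
  set Qbar : Polynomial (ResidueField V) := QV.map (residue V) with hQbar
  have hQbarR : ∀ k, Qbar.coeff k ∈ resField V E := fun k => by
    rw [hQbar, coeff_map]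
    exact residue_mem_resField V _ (by rw [hQVcoeff]; exact hQE k)
  have hQbar0 : Qbar ≠ 0 := by
    intro h0
    have h1 : Qbar.coeff i₀ = 1 := by
      rw [hQbar, coeff_map]
      have : QV.coeff i₀ = 1 := Subtype.ext (by rw [hQVcoeff, hQi₀]; rfl)
      rw [this, map_one]
    rw [h0, coeff_zero] at h1
    exact zero_ne_one h1
  have hQbarw : Qbar.eval (residue V ⟨w, hwV⟩) = 0 := by
    rw [hQbar, ← residue_eval]
    have : QV.eval ⟨w, hwV⟩ = 0 := Subtype.ext (by rw [algebraMap_eval, hQV']; exact hQw)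
    rw [this, map_zero]
  -- descend to `(resField V E)[X]`
  obtain ⟨QR, hQR⟩ : ∃ QR : Polynomial (resField V E),
      QR.map (algebraMap (resField V E) (ResidueField V)) = Qbar :=
    (mem_lifts Qbar).mp ((lifts_iff_coeff_lifts Qbar).mpr fun k => ⟨⟨Qbar.coeff k, hQbarR k⟩, rfl⟩)
  refine ⟨QR, fun h0 => hQbar0 (by rw [← hQR, h0, Polynomial.map_zero]), ?_⟩
  rw [aeval_def, ← eval_map, hQR, hQbarw]

/-! ## `(E.K^sep | K^sep, 𝓟)` is immediate (Knaf–Kuhlmann 2009, proof of Thm. 1.1, n = 1) -/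

/-- Elements of `E.K^sep` are algebraic over `E ⊇ K`: a polynomial relation with
coefficients in `E`. [folklore] -/
theorem exists_eval_eq_zero_of_mem_sup_separableClosure {E : Subfield Ω} (hKE : K ≤ E) {w : Ω}
    (hw : w ∈ E ⊔ (separableClosure K Ω).toSubfield) :
    ∃ P : Polynomial Ω, P ≠ 0 ∧ (∀ k, P.coeff k ∈ E) ∧ P.eval w = 0 := by
  set Ks := (separableClosure K Ω).toSubfield with hKs
  have hcl : Subfield.closure ((E : Set Ω) ∪ (Ks : Set Ω)) = E ⊔ Ks := by
    rw [closure_union_eq_sup, Subfield.closure_eq]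
  rw [← hcl] at hw
  have halg : IsAlgebraic E w := by
    refine isAlgebraic_of_mem_closure (fun x hx => ?_) hw
    have hxK : IsAlgebraic K x :=
      ((mem_toSubfield_separableClosure_iff K).mp hx).isIntegral.isAlgebraic
    exact isAlgebraic_of_subfield_le hKE hxK
  obtain ⟨P', hP'0, hP'w⟩ := halg
  refine ⟨P'.map (algebraMap E Ω), (Polynomial.map_ne_zero_iff (algebraMap E Ω).injective).mpr hP'0,
    fun k => by rw [coeff_map]; exact (P'.coeff k).2, by rw [eval_map, ← aeval_def, hP'w]⟩

section Immediate

variable [IsAlgClosed Ω]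

/-- **Values of `E.K^sep` are values of `K^sep`** (Knaf–Kuhlmann 2009, proof of Thm. 1.1:
"Since by assumption `vE/vK` is torsion and `EP|KP` is algebraic Lemma 2.1 implies that the
extension `(E^{sep}|K^{sep}, 𝓟)` and hence also its subextension `(E.K^{sep}|K^{sep}, 𝓟)` are
immediate" — the value-group half): if `vE/vK` is torsion then every non-zero `w ∈ E.K^sep`
has the value of a non-zero element of `K^sep`. PROVED. [cite: KnafKuhlmann2009, Section 4.1 (p. 20)] -/
theorem exists_mem_separableClosure_valuation_eq {E : Subfield Ω} (hKE : K ≤ E)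
    (htor : IsValueTorsionOver V K E) {w : Ω}
    (hw : w ∈ E ⊔ (separableClosure K Ω).toSubfield) (hw0 : w ≠ 0) :
    ∃ b ∈ (separableClosure K Ω).toSubfield, b ≠ 0 ∧ V.valuation w = V.valuation b := by
  obtain ⟨P, hP0, hPE, hPw⟩ := exists_eval_eq_zero_of_mem_sup_separableClosure K hKE hw
  obtain ⟨n, hn, e, heE, he0, hwe⟩ := exists_pow_valuation_eq_of_eval_eq_zero V E hP0 hPE hw0 hPw
  obtain ⟨m, hm, c, hcK, hec⟩ := htor e heE he0
  have hc0 : c ≠ 0 := by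
    rintro rfl
    rw [map_zero, map_pow, pow_eq_zero_iff hm, map_eq_zero] at hec
    exact he0 hec
  obtain ⟨b, hbK, hb0, hb⟩ := exists_mem_separableClosure_valuation_pow_eq V K
    (le_toSubfield_separableClosure K hcK) hc0 (mul_ne_zero hn hm)
  refine ⟨b, hbK, hb0, ?_⟩
  have h1 : V.valuation w ^ (n * m) = V.valuation b ^ (n * m) := by
    rw [hb, ← hec, map_pow, ← hwe, pow_mul]
  exact (pow_left_strictMonoOn₀ (mul_ne_zero hn hm)).injOn zero_le zero_le h1

/-- **Residues of `O_{E.K^sep}` are residues of `O_{K^sep}`** (the residue-field half of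
the same statement), for `v` non-trivial on `K`: if `EP|KP` is algebraic then every
`w ∈ O_{E.K^sep}` is congruent modulo the maximal ideal to an element of `O_{K^sep}`.
PROVED. [cite: KnafKuhlmann2009, Section 4.1 (p. 20)] -/
theorem exists_mem_separableClosure_valuation_sub_lt {E : Subfield Ω} (hKE : K ≤ E)
    {π : Ω} (hπK : π ∈ K) (hπ0 : π ≠ 0) (hvπ : V.valuation π < 1)
    (hres : IsResiduallyAlgebraicOver V K E) {w : Ω}
    (hw : w ∈ E ⊔ (separableClosure K Ω).toSubfield) (hwV : w ∈ V) :
    ∃ c ∈ (separableClosure K Ω).toSubfield, c ∈ V ∧ V.valuation (w - c) < 1 := by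
  obtain ⟨P, hP0, hPE, hPw⟩ := exists_eval_eq_zero_of_mem_sup_separableClosure K hKE hw
  have h1 : IsAlgebraic (resField V E) (residue V ⟨w, hwV⟩) :=
    isAlgebraic_residue_of_eval_eq_zero V E hP0 hPE hwV hPw
  have h2 : IsAlgebraic (resField V K) (residue V ⟨w, hwV⟩) :=
    isAlgebraic_trans_subfield (resField_mono V hKE) hres h1
  obtain ⟨c, hcK, hc⟩ := exists_residue_eq_of_isAlgebraic V K hπK hπ0 hvπ h2
  refine ⟨c, hcK, c.2, ?_⟩
  have := (residue_eq_residue_iff V ⟨w, hwV⟩ c).mp hc.symm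
  exact this

end Immediate

end Literature.AlgebraicGeometry.Resolution

end
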